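import Literature.AlgebraicGeometry.Motives.AbelianVarietyTateModuleTraceDimensionFormula
import HarnessLib

/-!
# The `ℓ`-adic Galois representation of a Kani–Rosen factor is the `H`-invariant part:
# `charpoly(σ | T_ℓ B_H) = charpoly(σ | (T_ℓ X)^H)` for every `σ ∈ Gal(K̄/K)`, `B_H = Im N_H`

For an abelian variety `X` over a field `K` with an action `ρ : G → End X`, a finite subgroup `H ≤ G` with norm element
`N_H = Σ_{h ∈ H} ρ(h)` and factor `B_H := Im N_H`, and a prime `ℓ` invertible in `K`, the prequel
(`Motives/AbelianVarietyTateModuleTraceDimensionFormula` §4) embeds `T_ℓ B_H` by `T_ℓ ι_H` into the invariants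
`(T_ℓ X)^H = ⋂_{h ∈ H} {x | T_ℓ ρ(h) x = x}` with `|H| · (T_ℓ X)^H` inside the image, whence `rk (T_ℓ X)^H = rk T_ℓ B_H`.
Here the GALOIS structure is added — the additive functor lemma of Dokchitser–Green–Konstantinou–Morgan "as Galois
modules" ("`Hom_G(Ind_H^G ρ, H¹_ℓ(X)) ≃ H¹_ℓ(X)^H ≃ H¹_ℓ(X/H)`", used there for root numbers and `L`-functions of the
quotient curves):

* `(T_ℓ X)^H` is stable under `Γ_K = Gal(K̄/K)` (the Galois action commutes with `T_ℓ` of `K`-endomorphisms,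
  `tateModuleMap_smul`), so `σ ↦ σ|_{(T_ℓ X)^H}` is a sub-representation (`tateRep_apply_mem_iInf_eqLocus`);
* `T_ℓ ι_H : T_ℓ B_H → (T_ℓ X)^H` is `Γ_K`-equivariant, injective, between free `ℤ_ℓ`-modules of the same rank;
* LATTICE LEMMA (§1): two endomorphisms `α` of `M` and `β` of `N` (free `ℤ_ℓ`-modules of equal finite rank) intertwined
  by an injective `f : M → N` have the same characteristic polynomial — after the flat base change `ℤ_ℓ → ℚ_ℓ`, `f` becomes
  an isomorphism conjugating `α ⊗ ℚ_ℓ` into `β ⊗ ℚ_ℓ`, and `charpoly` commutes with base change and `ℤ_ℓ[X] ↪ ℚ_ℓ[X]`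
  (the argument of the tree's `IsIsogenous.charpoly_tateRep_eq`, Tate 1966 §1 / Serre–Tate §1 "`V_ℓ = T_ℓ ⊗ ℚ_ℓ`");

hence **`charpoly(σ | T_ℓ B_H) = charpoly(σ | (T_ℓ X)^H)` in `ℤ_ℓ[X]`** (`charpoly_tateRep_image_norm_eq_charpoly_restrict`)
and `Tr(σ | T_ℓ B_H) = Tr(σ | (T_ℓ X)^H)`; over a finite field, Milne's `P_{B_H}(X) = charpoly(π_{B_H} | T_ℓ B_H)` is the
characteristic polynomial of the arithmetic Frobenius on `(T_ℓ X)^H` (`charpoly_frobenius_image_norm_eq_charpoly_restrict`: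
"the zeta function of the quotient is read off the `H`-invariants").  Transporting the `ℓ`-adic Kani–Rosen / Brauer-relation
identities of `Motives/AbelianVarietyGaloisCharpolyIsogenyRelations` along §3 gives ARTIN FORMALISM for the invariant
sublattices of `T_ℓ X` (§5): `∏_i charpoly(σ | (T_ℓ X)^{H_i})^{n_i} = 1` for every Brauer relation `Σ_i n_i H_i` of a finite
`G` acting on `X` (perfect field), and equality for Gassmann-equivalent subgroups.

## Main statements (sorry-free; theorems only, no new definitions)

* §1 `charpoly_eq_of_comp_eq_of_injective_of_finrank_eq` (the lattice lemma over `ℤ_ℓ`), `LinearMap.trace` form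
  `trace_eq_of_comp_eq_of_injective_of_finrank_eq`.
* §2 `tateModuleMap_asHom_comp_tateRep` (`T_ℓ ρ(g) ∘ σ = σ ∘ T_ℓ ρ(g)`), **`tateRep_apply_mem_iInf_eqLocus`** (`Γ_K`-stability
  of `(T_ℓ X)^H`), `tateModuleMap_imageι_mem_iInf_eqLocus`, `codRestrict_tateModuleMap_imageι_comp_tateRep`
  (equivariance of `T_ℓ ι_H : T_ℓ B_H → (T_ℓ X)^H`).
* §3 **`charpoly_tateRep_image_norm_eq_charpoly_restrict`**, `trace_tateRep_image_norm_eq_trace_restrict`,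
  `det_tateRep_image_norm_eq_det_restrict`, `charpoly_tateRep_image_norm_eq_of_iInf_eqLocus_eq_top` (`H` acts trivially on
  `T_ℓ X` ⟹ `charpoly(σ | T_ℓ B_H) = charpoly(σ | T_ℓ X)`).
* §4 finite base field: **`charpoly_frobenius_image_norm_eq_charpoly_restrict`** (`P_{B_H} = charpoly(φ | (T_ℓ X)^H)`) and
  `charpoly_frobenius_image_norm_eq_charpoly_restrict_tateModuleMap_frobeniusHom` (`= charpoly(T_ℓ π_X | (T_ℓ X)^H)`).
* §5 Artin formalism on the invariant sublattices (perfect field, `G` finite): **`prod_charpoly_restrict_pow_eq_of_sum_smul_indClassFun_one_eq`**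
  (`Σ_i a_i 1_{H_i}^G = Σ_j a'_j 1_{H'_j}^G ⟹ ∏_i charpoly(σ | (T_ℓ X)^{H_i})^{a_i} = ∏_j charpoly(σ | (T_ℓ X)^{H'_j})^{a'_j}`),
  `prod_charpoly_restrict_pow_toNat_eq_of_sum_intCast_smul_indClassFun_one_eq_zero` (signed Brauer relations),
  `sum_mul_trace_restrict_eq_zero_of_sum_intCast_smul_indClassFun_one_eq_zero` (`Σ_i n_i Tr(σ | (T_ℓ X)^{H_i}) = 0`),
  **`charpoly_restrict_eq_of_gassmann`** (Gassmann pairs).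

Scope (stated, not hidden).  `ℓ` invertible in `K` throughout §3 (freeness/finiteness of `T_ℓ`); integral statement in
`ℤ_ℓ[X]` (the lattices `T_ℓ B_H` and `(T_ℓ X)^H` themselves need not be isomorphic `Γ_K`-modules when `ℓ ∣ |H|`);
`B_H = Im N_H`; no `L`-functions, no quotient curves.

## References

* [DokchitserEtAl2022] V. Dokchitser, H. Green, A. Konstantinou, A. Morgan, *Parity of ranks of Jacobians of curves*
  (2022), §3 (additive functor lemma) and the Galois-module isomorphisms `H¹_ℓ(X)^H ≃ H¹_ℓ(X/H)` in the proof of the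
  root-number formalism.
* [Tate1966Endomorphisms] J. Tate, *Endomorphisms of abelian varieties over finite fields*, Invent. Math. 2 (1966), §1.
* [SerreTate1968] J.-P. Serre, J. Tate, *Good reduction of abelian varieties*, Ann. Math. 88 (1968), §1 (p. 493).
* [Milne1986AbelianVarieties] J. S. Milne, *Abelian varieties* (1986), §19, proof of Thm. 19.1 (pp. 144–145).
* [MumfordAV1970] D. Mumford, *Abelian Varieties* (1970), §19 Thm. 3 (p. 176) and p. 172.
* [KaniRosen1989] E. Kani, M. Rosen, *Idempotent relations and factors of Jacobians*, Math. Ann. 284 (1989), Thm. 3.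
* [PrasadRajan2003] D. Prasad, C. S. Rajan, *On an archimedean analogue of Tate's conjecture*, J. Number Theory 99
  (2003), Cor. 4; [Perlis1977] R. Perlis, *On the equation `ζ_K(s) = ζ_{K'}(s)`*, J. Number Theory 9 (1977), Thm. 1.
-/

noncomputable section

open CategoryTheory CategoryTheory.Limits
open scoped TensorProduct
open Literature.RepresentationTheory.FiniteGroups
open Literature.NumberTheory.DiophantineGeometry

universe u

namespace Literature.AlgebraicGeometry.Motives

namespace AbelianVariety

/-! ## §1 The lattice lemma: intertwined endomorphisms of `ℤ_ℓ`-lattices of equal rank have equal characteristic polynomials -/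

section Lattice

variable (ℓ : ℕ) [Fact ℓ.Prime] {M N : Type*} [AddCommGroup M] [Module ℤ_[ℓ] M] [Module.Free ℤ_[ℓ] M]
  [Module.Finite ℤ_[ℓ] M] [AddCommGroup N] [Module ℤ_[ℓ] N] [Module.Free ℤ_[ℓ] N] [Module.Finite ℤ_[ℓ] N]

/-- **The lattice lemma.**  Let `f : M → N` be an injective `ℤ_ℓ`-linear map between free `ℤ_ℓ`-modules of the same finite
rank and `α ∈ End M`, `β ∈ End N` with `f ∘ α = β ∘ f`.  Then `charpoly α = charpoly β` in `ℤ_ℓ[X]`: over `ℚ_ℓ`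
(flat over `ℤ_ℓ`) `f ⊗ ℚ_ℓ` is injective between spaces of equal dimension, hence an isomorphism conjugating `α ⊗ ℚ_ℓ` to
`β ⊗ ℚ_ℓ`; characteristic polynomials commute with base change and `ℤ_ℓ[X] → ℚ_ℓ[X]` is injective ("`V_ℓ = T_ℓ ⊗ ℚ_ℓ`";
the tree's argument for `IsIsogenous.charpoly_tateRep_eq`). [cite: SerreTate1968, §1 (p. 493)] [cite: Tate1966Endomorphisms, §1] -/
theorem charpoly_eq_of_comp_eq_of_injective_of_finrank_eq (f : M →ₗ[ℤ_[ℓ]] N) (hf : Function.Injective f)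
    (hrk : Module.finrank ℤ_[ℓ] M = Module.finrank ℤ_[ℓ] N) (α : M →ₗ[ℤ_[ℓ]] M) (β : N →ₗ[ℤ_[ℓ]] N)
    (h : f ∘ₗ α = β ∘ₗ f) : α.charpoly = β.charpoly := by
  apply Polynomial.map_injective (algebraMap ℤ_[ℓ] ℚ_[ℓ]) (IsFractionRing.injective ℤ_[ℓ] ℚ_[ℓ])
  rw [← LinearMap.charpoly_baseChange, ← LinearMap.charpoly_baseChange]
  haveI : Module.Flat ℤ_[ℓ] ℚ_[ℓ] := IsLocalization.flat ℚ_[ℓ] (nonZeroDivisors ℤ_[ℓ])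
  have hinj : Function.Injective (f.baseChange ℚ_[ℓ]) := by
    rw [LinearMap.baseChange_eq_ltensor]
    exact Module.Flat.lTensor_preserves_injective_linearMap _ hf
  have hdim : Module.finrank ℚ_[ℓ] (ℚ_[ℓ] ⊗[ℤ_[ℓ]] M) = Module.finrank ℚ_[ℓ] (ℚ_[ℓ] ⊗[ℤ_[ℓ]] N) := by
    rw [Module.finrank_baseChange, Module.finrank_baseChange, hrk]
  have hsurj : Function.Surjective (f.baseChange ℚ_[ℓ]) :=
    (LinearMap.injective_iff_surjective_of_finrank_eq_finrank hdim).1 hinj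
  let e : ℚ_[ℓ] ⊗[ℤ_[ℓ]] M ≃ₗ[ℚ_[ℓ]] ℚ_[ℓ] ⊗[ℤ_[ℓ]] N := LinearEquiv.ofBijective (f.baseChange ℚ_[ℓ]) ⟨hinj, hsurj⟩
  have he : ∀ x, e x = f.baseChange ℚ_[ℓ] x := fun _ ↦ rfl
  have hcomm : f.baseChange ℚ_[ℓ] ∘ₗ α.baseChange ℚ_[ℓ] = β.baseChange ℚ_[ℓ] ∘ₗ f.baseChange ℚ_[ℓ] := by
    rw [← LinearMap.baseChange_comp, ← LinearMap.baseChange_comp, h]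
  have hconj : e.conj (α.baseChange ℚ_[ℓ]) = β.baseChange ℚ_[ℓ] := by
    refine LinearMap.ext fun y ↦ ?_
    obtain ⟨x, rfl⟩ := e.surjective y
    rw [LinearEquiv.conj_apply, LinearMap.comp_apply, LinearMap.comp_apply, LinearEquiv.coe_coe, LinearEquiv.coe_coe,
      e.symm_apply_apply, he, he, ← LinearMap.comp_apply, hcomm, LinearMap.comp_apply]
  rw [← hconj, LinearEquiv.charpoly_conj]

/-- The trace form of the lattice lemma: `Tr α = Tr β`. [cite: SerreTate1968, §1 (p. 493)] [cite: Tate1966Endomorphisms, §1] -/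
theorem trace_eq_of_comp_eq_of_injective_of_finrank_eq (f : M →ₗ[ℤ_[ℓ]] N) (hf : Function.Injective f)
    (hrk : Module.finrank ℤ_[ℓ] M = Module.finrank ℤ_[ℓ] N) (α : M →ₗ[ℤ_[ℓ]] M) (β : N →ₗ[ℤ_[ℓ]] N)
    (h : f ∘ₗ α = β ∘ₗ f) : LinearMap.trace ℤ_[ℓ] M α = LinearMap.trace ℤ_[ℓ] N β := by
  rw [trace_eq_neg_nextCoeff_charpoly, trace_eq_neg_nextCoeff_charpoly,
    charpoly_eq_of_comp_eq_of_injective_of_finrank_eq ℓ f hf hrk α β h]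

end Lattice

/-! ## §2 `Γ_K`-stability of the invariants `(T_ℓ X)^H` and equivariance of `T_ℓ ι_H` -/

section Stability

variable {K : Type u} [Field K] (ℓ : ℕ) [Fact ℓ.Prime] {X : AbelianVariety K} {G : Type} [Group G] (ρ : G →* End X)

/-- The Galois action commutes with `T_ℓ` of an endomorphism defined over `K`: `T_ℓ ρ(g) ∘ σ = σ ∘ T_ℓ ρ(g)`
("`Hom(A, B) → Hom_{ℤ_ℓ}(T_ℓ A, T_ℓ B)` lands in the `Γ_K`-invariants"). [cite: MumfordAV1970, §19 Thm. 3 (p. 176)] -/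
theorem tateModuleMap_asHom_comp_tateRep (g : G) (σ : Field.absoluteGaloisGroup K) :
    tateModuleMap ℓ (End.asHom (ρ g)) ∘ₗ X.tateRep ℓ σ = X.tateRep ℓ σ ∘ₗ tateModuleMap ℓ (End.asHom (ρ g)) :=
  LinearMap.ext fun x ↦ tateModuleMap_smul (End.asHom (ρ g)) σ x

/-- **`(T_ℓ X)^H` is a `Γ_K`-submodule**: `σ` maps `⋂_{h ∈ H} {x | T_ℓ ρ(h) x = x}` into itself.
[cite: DokchitserEtAl2022, §3 (additive functor lemma, `F(J_X)^H` as a Galois module)] [cite: MumfordAV1970, §19 Thm. 3 (p. 176)] -/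
theorem tateRep_apply_mem_iInf_eqLocus (H : Subgroup G) (σ : Field.absoluteGaloisGroup K) :
    ∀ x ∈ (⨅ h : H, LinearMap.eqLocus (tateModuleMap ℓ (End.asHom (ρ h))) LinearMap.id),
      X.tateRep ℓ σ x ∈ (⨅ h : H, LinearMap.eqLocus (tateModuleMap ℓ (End.asHom (ρ h))) LinearMap.id) := by
  intro x hx
  rw [Submodule.mem_iInf] at hx ⊢
  intro h
  have hx' := LinearMap.mem_eqLocus.1 (hx h)
  rw [LinearMap.id_apply] at hx'
  refine LinearMap.mem_eqLocus.2 ?_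
  rw [LinearMap.id_apply, ← LinearMap.comp_apply, tateModuleMap_asHom_comp_tateRep, LinearMap.comp_apply, hx']

variable {H : Subgroup G} [Fintype H] {N : X ⟶ X}

/-- `T_ℓ ι_H` lands in `(T_ℓ X)^H` (pointwise form of `range_tateModuleMap_imageι_norm_le`).
[cite: DokchitserEtAl2022, §3 (additive functor lemma)] -/
theorem tateModuleMap_imageι_mem_iInf_eqLocus (hN : End.of N = ∑ h : H, ρ h) (y : (image N).tateModule ℓ) :
    tateModuleMap ℓ (imageι N) y ∈ (⨅ h : H, LinearMap.eqLocus (tateModuleMap ℓ (End.asHom (ρ h))) LinearMap.id) :=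
  range_tateModuleMap_imageι_norm_le ℓ ρ hN ⟨y, rfl⟩

/-- **`T_ℓ ι_H : T_ℓ B_H → (T_ℓ X)^H` is `Γ_K`-equivariant**: `ι̃ ∘ σ_{B_H} = σ|_{(T_ℓ X)^H} ∘ ι̃` for the corestriction
`ι̃` of `T_ℓ ι_H`. [cite: DokchitserEtAl2022, §3 (additive functor lemma, as Galois modules)] [cite: MumfordAV1970, §19 Thm. 3 (p. 176)] -/
theorem codRestrict_tateModuleMap_imageι_comp_tateRep (hN : End.of N = ∑ h : H, ρ h) (σ : Field.absoluteGaloisGroup K) :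
    LinearMap.codRestrict _ (tateModuleMap ℓ (imageι N)) (tateModuleMap_imageι_mem_iInf_eqLocus ℓ ρ hN) ∘ₗ
        (image N).tateRep ℓ σ =
      (X.tateRep ℓ σ).restrict (tateRep_apply_mem_iInf_eqLocus ℓ ρ H σ) ∘ₗ
        LinearMap.codRestrict _ (tateModuleMap ℓ (imageι N)) (tateModuleMap_imageι_mem_iInf_eqLocus ℓ ρ hN) := by
  refine LinearMap.ext fun y ↦ Subtype.ext ?_
  change tateModuleMap ℓ (imageι N) ((image N).tateRep ℓ σ y) = X.tateRep ℓ σ (tateModuleMap ℓ (imageι N) y)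
  exact tateModuleMap_smul (imageι N) σ y

end Stability

/-! ## §3 `charpoly(σ | T_ℓ B_H) = charpoly(σ | (T_ℓ X)^H)` -/

section Charpoly

variable {K : Type u} [Field K] (ℓ : ℕ) [Fact ℓ.Prime] {X : AbelianVariety K} {G : Type} [Group G] (ρ : G →* End X)
  {H : Subgroup G} [Fintype H] {N : X ⟶ X}

/-- **The `ℓ`-adic Galois representation of `B_H = Im N_H` is the `H`-invariant part of that of `X`, up to isogeny:
`charpoly(σ | T_ℓ B_H) = charpoly(σ | (T_ℓ X)^H)` in `ℤ_ℓ[X]` for every `σ ∈ Gal(K̄/K)`** (`ℓ` invertible in `K`; the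
instances on `T_ℓ B_H`, `T_ℓ X` come from `module_free_tateModule_holds` / `module_finite_tateModule_of_cast_ne_zero`, those
on the invariant sublattice — a submodule of a free `ℤ_ℓ`-module of finite rank — from Mathlib).  Proof: the lattice lemma
for the equivariant injection `T_ℓ ι_H : T_ℓ B_H ↪ (T_ℓ X)^H` of equal rank (`finrank_iInf_eqLocus_tateModuleMap_eq_finrank`).
[cite: DokchitserEtAl2022, §3 (additive functor lemma with `F = V_ℓ`, as Galois modules: `H¹_ℓ(X)^H ≃ H¹_ℓ(X/H)`)]
[cite: Tate1966Endomorphisms, §1] [cite: SerreTate1968, §1 (p. 493)] -/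
theorem charpoly_tateRep_image_norm_eq_charpoly_restrict (hN : End.of N = ∑ h : H, ρ h) (hℓ : (ℓ : K) ≠ 0)
    (σ : Field.absoluteGaloisGroup K) :
    haveI := (image N).module_free_tateModule_holds ℓ hℓ
    haveI := module_finite_tateModule_of_cast_ne_zero (image N) ℓ hℓ
    haveI := X.module_free_tateModule_holds ℓ hℓ
    haveI := module_finite_tateModule_of_cast_ne_zero X ℓ hℓ
    ((image N).tateRep ℓ σ).charpoly =
      ((X.tateRep ℓ σ).restrict (tateRep_apply_mem_iInf_eqLocus ℓ ρ H σ)).charpoly := by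
  haveI := (image N).module_free_tateModule_holds ℓ hℓ
  haveI := module_finite_tateModule_of_cast_ne_zero (image N) ℓ hℓ
  haveI := X.module_free_tateModule_holds ℓ hℓ
  haveI := module_finite_tateModule_of_cast_ne_zero X ℓ hℓ
  refine charpoly_eq_of_comp_eq_of_injective_of_finrank_eq ℓ
    (LinearMap.codRestrict _ (tateModuleMap ℓ (imageι N)) (tateModuleMap_imageι_mem_iInf_eqLocus ℓ ρ hN))
    (fun y y' hyy' ↦ tateModuleMap_imageι_injective ℓ (norm_comp_norm_eq_card_nsmul ρ hN) Fintype.card_ne_zero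
      (congrArg Subtype.val hyy'))
    (finrank_iInf_eqLocus_tateModuleMap_eq_finrank ℓ ρ hN).symm _ _
    (codRestrict_tateModuleMap_imageι_comp_tateRep ℓ ρ hN σ)

/-- **`Tr(σ | T_ℓ B_H) = Tr(σ | (T_ℓ X)^H)`** for every `σ ∈ Gal(K̄/K)` (`ℓ` invertible in `K`).
[cite: DokchitserEtAl2022, §3 (additive functor lemma, as Galois modules)] [cite: Tate1966Endomorphisms, §1] -/
theorem trace_tateRep_image_norm_eq_trace_restrict (hN : End.of N = ∑ h : H, ρ h) (hℓ : (ℓ : K) ≠ 0)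
    (σ : Field.absoluteGaloisGroup K) :
    LinearMap.trace ℤ_[ℓ] ((image N).tateModule ℓ) ((image N).tateRep ℓ σ) =
      LinearMap.trace ℤ_[ℓ] _ ((X.tateRep ℓ σ).restrict (tateRep_apply_mem_iInf_eqLocus ℓ ρ H σ)) := by
  haveI := (image N).module_free_tateModule_holds ℓ hℓ
  haveI := module_finite_tateModule_of_cast_ne_zero (image N) ℓ hℓ
  haveI := X.module_free_tateModule_holds ℓ hℓ
  haveI := module_finite_tateModule_of_cast_ne_zero X ℓ hℓ
  exact trace_eq_of_comp_eq_of_injective_of_finrank_eq ℓ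
    (LinearMap.codRestrict _ (tateModuleMap ℓ (imageι N)) (tateModuleMap_imageι_mem_iInf_eqLocus ℓ ρ hN))
    (fun y y' hyy' ↦ tateModuleMap_imageι_injective ℓ (norm_comp_norm_eq_card_nsmul ρ hN) Fintype.card_ne_zero
      (congrArg Subtype.val hyy'))
    (finrank_iInf_eqLocus_tateModuleMap_eq_finrank ℓ ρ hN).symm _ _
    (codRestrict_tateModuleMap_imageι_comp_tateRep ℓ ρ hN σ)

/-- **`det(σ | T_ℓ B_H) = det(σ | (T_ℓ X)^H)`** for every `σ ∈ Gal(K̄/K)` (`ℓ` invertible in `K`): the constant coefficients of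
the equal characteristic polynomials, the ranks being equal. [cite: DokchitserEtAl2022, §3 (additive functor lemma, as Galois modules)]
[cite: Tate1966Endomorphisms, §1] -/
theorem det_tateRep_image_norm_eq_det_restrict (hN : End.of N = ∑ h : H, ρ h) (hℓ : (ℓ : K) ≠ 0)
    (σ : Field.absoluteGaloisGroup K) :
    LinearMap.det ((image N).tateRep ℓ σ) =
      LinearMap.det ((X.tateRep ℓ σ).restrict (tateRep_apply_mem_iInf_eqLocus ℓ ρ H σ)) := by
  haveI := (image N).module_free_tateModule_holds ℓ hℓ
  haveI := module_finite_tateModule_of_cast_ne_zero (image N) ℓ hℓ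
  haveI := X.module_free_tateModule_holds ℓ hℓ
  haveI := module_finite_tateModule_of_cast_ne_zero X ℓ hℓ
  rw [det_eq_neg_one_pow_mul_charpoly_coeff_zero, det_eq_neg_one_pow_mul_charpoly_coeff_zero,
    charpoly_tateRep_image_norm_eq_charpoly_restrict ℓ ρ hN hℓ σ, ← finrank_iInf_eqLocus_tateModuleMap_eq_finrank ℓ ρ hN]

/-- **If `H` acts trivially on `T_ℓ X` then `T_ℓ B_H` and `T_ℓ X` have the same characteristic polynomials of Galois**:
`(T_ℓ X)^H = T_ℓ X ⟹ charpoly(σ | T_ℓ B_H) = charpoly(σ | T_ℓ X)` — the lattice lemma for `T_ℓ ι_H : T_ℓ B_H ↪ T_ℓ X`, whose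
rank is then full. [cite: DokchitserEtAl2022, §3 (additive functor lemma)] [cite: Tate1966Endomorphisms, §1] -/
theorem charpoly_tateRep_image_norm_eq_of_iInf_eqLocus_eq_top (hN : End.of N = ∑ h : H, ρ h) (hℓ : (ℓ : K) ≠ 0)
    (htop : (⨅ h : H, LinearMap.eqLocus (tateModuleMap ℓ (End.asHom (ρ h))) LinearMap.id) = ⊤)
    (σ : Field.absoluteGaloisGroup K) :
    haveI := (image N).module_free_tateModule_holds ℓ hℓ
    haveI := module_finite_tateModule_of_cast_ne_zero (image N) ℓ hℓ
    haveI := X.module_free_tateModule_holds ℓ hℓ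
    haveI := module_finite_tateModule_of_cast_ne_zero X ℓ hℓ
    ((image N).tateRep ℓ σ).charpoly = (X.tateRep ℓ σ).charpoly := by
  haveI := (image N).module_free_tateModule_holds ℓ hℓ
  haveI := module_finite_tateModule_of_cast_ne_zero (image N) ℓ hℓ
  haveI := X.module_free_tateModule_holds ℓ hℓ
  haveI := module_finite_tateModule_of_cast_ne_zero X ℓ hℓ
  have hrk : Module.finrank ℤ_[ℓ] ((image N).tateModule ℓ) = Module.finrank ℤ_[ℓ] (X.tateModule ℓ) := by
    rw [← finrank_iInf_eqLocus_tateModuleMap_eq_finrank ℓ ρ hN, htop, finrank_top]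
  exact charpoly_eq_of_comp_eq_of_injective_of_finrank_eq ℓ (tateModuleMap ℓ (imageι N))
    (tateModuleMap_imageι_injective ℓ (norm_comp_norm_eq_card_nsmul ρ hN) Fintype.card_ne_zero) hrk _ _
    (LinearMap.ext fun y ↦ tateModuleMap_smul (imageι N) σ y)

end Charpoly

/-! ## §4 Finite base field: `P_{B_H} = charpoly(Frob | (T_ℓ X)^H)` -/

section FiniteField

variable {K : Type u} [Field K] [Finite K] (ℓ : ℕ) [Fact ℓ.Prime] {X : AbelianVariety K} {G : Type} [Group G]
  (ρ : G →* End X) {H : Subgroup G} [Fintype H] {N : X ⟶ X}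

/-- **Over a finite field, the characteristic polynomial of Frobenius of `B_H = Im N_H` is that of the arithmetic Frobenius
on the `H`-invariants of `T_ℓ X`**: `P_{B_H}(X) = charpoly(π_{B_H} | T_ℓ B_H) = charpoly(φ | (T_ℓ X)^H)` (`ℓ ∤ q`;
`T_ℓ(π_B) = ρ_B(φ)`, `tateModuleMap_frobeniusHom_eq_tateRep_arithFrob`) — for `X = J_C`, `G ≤ Aut C` the numerator of the
zeta function of `C/H` read off the `H`-invariants (quotient-curve reading not asserted).
[cite: Milne1986AbelianVarieties, §19, proof of Thm. 19.1 (pp. 144–145)] [cite: DokchitserEtAl2022, §3 (additive functor lemma, as Galois modules)] -/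
theorem charpoly_frobenius_image_norm_eq_charpoly_restrict (hN : End.of N = ∑ h : H, ρ h) (hℓ : (ℓ : K) ≠ 0) :
    haveI := (image N).module_free_tateModule_holds ℓ hℓ
    haveI := module_finite_tateModule_of_cast_ne_zero (image N) ℓ hℓ
    haveI := X.module_free_tateModule_holds ℓ hℓ
    haveI := module_finite_tateModule_of_cast_ne_zero X ℓ hℓ
    (tateModuleMap ℓ (frobeniusHom (image N))).charpoly =
      ((X.tateRep ℓ (arithFrob K)).restrict (tateRep_apply_mem_iInf_eqLocus ℓ ρ H (arithFrob K))).charpoly := by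
  haveI := (image N).module_free_tateModule_holds ℓ hℓ
  haveI := module_finite_tateModule_of_cast_ne_zero (image N) ℓ hℓ
  rw [charpoly_tateModuleMap_frobeniusHom_eq_charpoly_tateRep]
  exact charpoly_tateRep_image_norm_eq_charpoly_restrict ℓ ρ hN hℓ (arithFrob K)

/-- The same through the restriction of `T_ℓ(π_X)` itself: `P_{B_H} = charpoly(T_ℓ π_X | (T_ℓ X)^H)` (the Frobenius
endomorphism of `X` preserves the `H`-invariants, being `ρ_X(φ)` on `T_ℓ X`). [cite: Milne1986AbelianVarieties, §19, proof of Thm. 19.1 (pp. 144–145)]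
[cite: DokchitserEtAl2022, §3 (additive functor lemma)] -/
theorem charpoly_frobenius_image_norm_eq_charpoly_restrict_tateModuleMap_frobeniusHom (hN : End.of N = ∑ h : H, ρ h)
    (hℓ : (ℓ : K) ≠ 0) :
    haveI := (image N).module_free_tateModule_holds ℓ hℓ
    haveI := module_finite_tateModule_of_cast_ne_zero (image N) ℓ hℓ
    haveI := X.module_free_tateModule_holds ℓ hℓ
    haveI := module_finite_tateModule_of_cast_ne_zero X ℓ hℓ
    (tateModuleMap ℓ (frobeniusHom (image N))).charpoly =
      ((tateModuleMap ℓ (frobeniusHom X)).restrict (p := ⨅ h : H, LinearMap.eqLocus (tateModuleMap ℓ (End.asHom (ρ h)))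
          LinearMap.id) (q := ⨅ h : H, LinearMap.eqLocus (tateModuleMap ℓ (End.asHom (ρ h))) LinearMap.id)
        (fun x hx ↦ by
          rw [tateModuleMap_frobeniusHom_eq_tateRep_arithFrob]
          exact tateRep_apply_mem_iInf_eqLocus ℓ ρ H (arithFrob K) x hx)).charpoly := by
  haveI := (image N).module_free_tateModule_holds ℓ hℓ
  haveI := module_finite_tateModule_of_cast_ne_zero (image N) ℓ hℓ
  haveI := X.module_free_tateModule_holds ℓ hℓ
  haveI := module_finite_tateModule_of_cast_ne_zero X ℓ hℓ
  rw [charpoly_frobenius_image_norm_eq_charpoly_restrict ℓ ρ hN hℓ]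
  congr 1
  refine LinearMap.ext fun x ↦ Subtype.ext ?_
  change X.tateRep ℓ (arithFrob K) x = tateModuleMap ℓ (frobeniusHom X) x
  rw [tateModuleMap_frobeniusHom_eq_tateRep_arithFrob]

end FiniteField

/-! ## §5 Artin formalism on the invariant sublattices of `T_ℓ X`: Brauer relations and Gassmann pairs -/

section ArtinFormalism

variable {K : Type u} [Field K] [PerfectField K] (ℓ : ℕ) [Fact ℓ.Prime] {X : AbelianVariety K} {G : Type} [Group G]
  [Fintype G] [DecidableEq G] (ρ : G →* End X) {ι ι' : Type} [Fintype ι] [Fintype ι'] [DecidableEq ι] [DecidableEq ι']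
  (H : ι → Subgroup G) (H' : ι' → Subgroup G) [∀ i, Fintype (H i)] [∀ j, Fintype (H' j)] (a : ι → ℕ) (a' : ι' → ℕ)

/-- **Artin formalism for the invariants of `T_ℓ X`, from Kani–Rosen's Theorem 3**: if the permutation characters satisfy
`Σ_i a_i (1_{H_i})^G = Σ_j a'_j (1_{H'_j})^G`, then for every action of the finite group `G` on an abelian variety `X` over a
perfect field, every prime `ℓ` invertible in `K` and every `σ ∈ Gal(K̄/K)`,
**`∏_i charpoly(σ | (T_ℓ X)^{H_i})^{a_i} = ∏_j charpoly(σ | (T_ℓ X)^{H'_j})^{a'_j}`** in `ℤ_ℓ[X]` — the `ℓ`-adic identity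
`∏_i charpoly(σ | T_ℓ B_{H_i})^{a_i} = ∏_j charpoly(σ | T_ℓ B_{H'_j})^{a'_j}` of `Motives/AbelianVarietyGaloisCharpolyIsogenyRelations`
transported to the invariants by §3 (`B_H = Im N_H` with `N_H = Σ_{h ∈ H} ρ(h)` chosen inside the proof).
[cite: KaniRosen1989, Thm. 3] [cite: DokchitserEtAl2022, §1.3 Thm. 1.3 and §3 (additive functor lemma, as Galois modules)] -/
theorem prod_charpoly_restrict_pow_eq_of_sum_smul_indClassFun_one_eq (hℓ : (ℓ : K) ≠ 0)
    (h : ∑ i, (a i : ℂ) • indClassFun (H i) (1 : H i → ℂ) = ∑ j, (a' j : ℂ) • indClassFun (H' j) (1 : H' j → ℂ))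
    (σ : Field.absoluteGaloisGroup K) :
    haveI := X.module_free_tateModule_holds ℓ hℓ
    haveI := module_finite_tateModule_of_cast_ne_zero X ℓ hℓ
    ∏ i, ((X.tateRep ℓ σ).restrict (tateRep_apply_mem_iInf_eqLocus ℓ ρ (H i) σ)).charpoly ^ a i =
      ∏ j, ((X.tateRep ℓ σ).restrict (tateRep_apply_mem_iInf_eqLocus ℓ ρ (H' j) σ)).charpoly ^ a' j := by
  haveI := X.module_free_tateModule_holds ℓ hℓ
  haveI := module_finite_tateModule_of_cast_ne_zero X ℓ hℓ
  have hN : ∀ i, End.of (End.asHom (∑ h : H i, ρ h)) = ∑ h : H i, ρ h := fun _ ↦ rfl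
  have hN' : ∀ j, End.of (End.asHom (∑ h : H' j, ρ h)) = ∑ h : H' j, ρ h := fun _ ↦ rfl
  haveI : ∀ i, Module.Free ℤ_[ℓ] ((image (End.asHom (∑ h : H i, ρ h))).tateModule ℓ) := fun i ↦
    (image _).module_free_tateModule_holds ℓ hℓ
  haveI : ∀ i, Module.Finite ℤ_[ℓ] ((image (End.asHom (∑ h : H i, ρ h))).tateModule ℓ) := fun i ↦
    module_finite_tateModule_of_cast_ne_zero (image _) ℓ hℓ
  haveI : ∀ j, Module.Free ℤ_[ℓ] ((image (End.asHom (∑ h : H' j, ρ h))).tateModule ℓ) := fun j ↦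
    (image _).module_free_tateModule_holds ℓ hℓ
  haveI : ∀ j, Module.Finite ℤ_[ℓ] ((image (End.asHom (∑ h : H' j, ρ h))).tateModule ℓ) := fun j ↦
    module_finite_tateModule_of_cast_ne_zero (image _) ℓ hℓ
  have key := prod_charpoly_tateRep_pow_eq_of_sum_smul_indClassFun_one_eq ℓ ρ H H' a a' hℓ h hN hN' σ
  simp only [charpoly_tateRep_image_norm_eq_charpoly_restrict ℓ ρ (hN _) hℓ σ,
    charpoly_tateRep_image_norm_eq_charpoly_restrict ℓ ρ (hN' _) hℓ σ] at key
  exact key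

omit [Fintype ι'] [DecidableEq ι'] in
/-- **A Brauer relation `Σ_i n_i H_i` (`Σ_i n_i (1_{H_i})^G = 0`) gives
`∏_{n_i > 0} charpoly(σ | (T_ℓ X)^{H_i})^{n_i} = ∏_{n_i < 0} charpoly(σ | (T_ℓ X)^{H_i})^{−n_i}`** for the invariant sublattices of
`T_ℓ X` (`X` with an action of the finite group `G` over a perfect field, `ℓ` invertible in `K`, `σ ∈ Γ_K`) — "for every
Brauer relation … there is an isogeny `∏_j Jac_{X/H_j'} → ∏_i Jac_{X/H_i}`", on `V_ℓ` and then on the invariants.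
[cite: DokchitserEtAl2022, §1.3 Thm. 1.3 and §3 (additive functor lemma, as Galois modules)] [cite: KaniRosen1989, Thm. 3] -/
theorem prod_charpoly_restrict_pow_toNat_eq_of_sum_intCast_smul_indClassFun_one_eq_zero (hℓ : (ℓ : K) ≠ 0) (n : ι → ℤ)
    (h0 : ∑ i, (n i : ℂ) • indClassFun (H i) (1 : H i → ℂ) = 0) (σ : Field.absoluteGaloisGroup K) :
    haveI := X.module_free_tateModule_holds ℓ hℓ
    haveI := module_finite_tateModule_of_cast_ne_zero X ℓ hℓ
    ∏ i, ((X.tateRep ℓ σ).restrict (tateRep_apply_mem_iInf_eqLocus ℓ ρ (H i) σ)).charpoly ^ (n i).toNat =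
      ∏ i, ((X.tateRep ℓ σ).restrict (tateRep_apply_mem_iInf_eqLocus ℓ ρ (H i) σ)).charpoly ^ (-n i).toNat := by
  haveI := X.module_free_tateModule_holds ℓ hℓ
  haveI := module_finite_tateModule_of_cast_ne_zero X ℓ hℓ
  have hN : ∀ i, End.of (End.asHom (∑ h : H i, ρ h)) = ∑ h : H i, ρ h := fun _ ↦ rfl
  haveI : ∀ i, Module.Free ℤ_[ℓ] ((image (End.asHom (∑ h : H i, ρ h))).tateModule ℓ) := fun i ↦
    (image _).module_free_tateModule_holds ℓ hℓ
  haveI : ∀ i, Module.Finite ℤ_[ℓ] ((image (End.asHom (∑ h : H i, ρ h))).tateModule ℓ) := fun i ↦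
    module_finite_tateModule_of_cast_ne_zero (image _) ℓ hℓ
  have key := prod_charpoly_tateRep_pow_toNat_eq_of_sum_intCast_smul_indClassFun_one_eq_zero ℓ ρ H hℓ n h0 hN σ
  simp only [charpoly_tateRep_image_norm_eq_charpoly_restrict ℓ ρ (hN _) hℓ σ] at key
  exact key

omit [Fintype ι'] [DecidableEq ι'] in
/-- **`Σ_i n_i Tr(σ | (T_ℓ X)^{H_i}) = 0`** for every Brauer relation `Σ_i n_i H_i` (the virtual representation
`Σ_i n_i (V_ℓ X)^{H_i}` of `Γ_K` has character zero). [cite: DokchitserEtAl2022, §1.3 Thm. 1.3 and §3] [cite: KaniRosen1989, Thm. 3] -/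
theorem sum_mul_trace_restrict_eq_zero_of_sum_intCast_smul_indClassFun_one_eq_zero (hℓ : (ℓ : K) ≠ 0) (n : ι → ℤ)
    (h0 : ∑ i, (n i : ℂ) • indClassFun (H i) (1 : H i → ℂ) = 0) (σ : Field.absoluteGaloisGroup K) :
    ∑ i, (n i : ℤ_[ℓ]) *
        LinearMap.trace ℤ_[ℓ] _ ((X.tateRep ℓ σ).restrict (tateRep_apply_mem_iInf_eqLocus ℓ ρ (H i) σ)) = 0 := by
  have hN : ∀ i, End.of (End.asHom (∑ h : H i, ρ h)) = ∑ h : H i, ρ h := fun _ ↦ rfl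
  haveI : ∀ i, Module.Free ℤ_[ℓ] ((image (End.asHom (∑ h : H i, ρ h))).tateModule ℓ) := fun i ↦
    (image _).module_free_tateModule_holds ℓ hℓ
  haveI : ∀ i, Module.Finite ℤ_[ℓ] ((image (End.asHom (∑ h : H i, ρ h))).tateModule ℓ) := fun i ↦
    module_finite_tateModule_of_cast_ne_zero (image _) ℓ hℓ
  have key := sum_mul_trace_tateRep_eq_zero_of_sum_intCast_smul_indClassFun_one_eq_zero ℓ ρ H hℓ n h0 hN σ
  simp only [trace_tateRep_image_norm_eq_trace_restrict ℓ ρ (hN _) hℓ σ] at key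
  exact key

end ArtinFormalism

section Gassmann

variable {K : Type u} [Field K] [PerfectField K] (ℓ : ℕ) [Fact ℓ.Prime] {X : AbelianVariety K} {G : Type} [Group G]
  [Fintype G] (ρ : G →* End X) (H₁ H₂ : Subgroup G) [Fintype H₁] [Fintype H₂]

/-- **Gassmann equivalent subgroups have invariant sublattices with the same characteristic polynomials of Galois**: if
`H₁, H₂ ≤ G` meet every conjugacy class of the finite group `G` in the same number of elements, then
`charpoly(σ | (T_ℓ X)^{H₁}) = charpoly(σ | (T_ℓ X)^{H₂})` for every `G`-action on an abelian variety over a perfect field, every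
`ℓ` invertible in `K` and every `σ ∈ Γ_K` (`B_{H₁} ∼ B_{H₂}`, the tree's `isIsogenous_of_gassmann`, on `T_ℓ` and then on the
invariants) — the `ℓ`-adic avatar of `ζ_{K^{H₁}} = ζ_{K^{H₂}}` for arithmetically equivalent fields.
[cite: PrasadRajan2003, Cor. 4] [cite: Perlis1977, Thm. 1] [cite: DokchitserEtAl2022, §3 (additive functor lemma, as Galois modules)] -/
theorem charpoly_restrict_eq_of_gassmann (hℓ : (ℓ : K) ≠ 0)
    (hG : ∀ g : G, Nat.card {h : H₁ // IsConj g h} = Nat.card {h : H₂ // IsConj g h}) (σ : Field.absoluteGaloisGroup K) :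
    haveI := X.module_free_tateModule_holds ℓ hℓ
    haveI := module_finite_tateModule_of_cast_ne_zero X ℓ hℓ
    ((X.tateRep ℓ σ).restrict (tateRep_apply_mem_iInf_eqLocus ℓ ρ H₁ σ)).charpoly =
      ((X.tateRep ℓ σ).restrict (tateRep_apply_mem_iInf_eqLocus ℓ ρ H₂ σ)).charpoly := by
  haveI := X.module_free_tateModule_holds ℓ hℓ
  haveI := module_finite_tateModule_of_cast_ne_zero X ℓ hℓ
  have hN₁ : End.of (End.asHom (∑ h : H₁, ρ h)) = ∑ h : H₁, ρ h := rfl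
  have hN₂ : End.of (End.asHom (∑ h : H₂, ρ h)) = ∑ h : H₂, ρ h := rfl
  haveI := (image (End.asHom (∑ h : H₁, ρ h))).module_free_tateModule_holds ℓ hℓ
  haveI := module_finite_tateModule_of_cast_ne_zero (image (End.asHom (∑ h : H₁, ρ h))) ℓ hℓ
  haveI := (image (End.asHom (∑ h : H₂, ρ h))).module_free_tateModule_holds ℓ hℓ
  haveI := module_finite_tateModule_of_cast_ne_zero (image (End.asHom (∑ h : H₂, ρ h))) ℓ hℓ
  rw [← charpoly_tateRep_image_norm_eq_charpoly_restrict ℓ ρ hN₁ hℓ σ,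
    ← charpoly_tateRep_image_norm_eq_charpoly_restrict ℓ ρ hN₂ hℓ σ]
  exact charpoly_tateRep_eq_of_gassmann ℓ ρ H₁ H₂ hℓ hG hN₁ hN₂ σ

end Gassmann

end AbelianVariety

end Literature.AlgebraicGeometry.Motives
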